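import Summits.ResolutionOfSingularities.ResolutionOfSingularities.Theorems.ItineraryCutClasses
import Summits.ResolutionOfSingularities.ResolutionOfSingularities.Theorems.BoundaryLedgerClasses
import Summits.ResolutionOfSingularities.ResolutionOfSingularities.Theorems.JumpCutModel
import HarnessLib

/-!
# FloorCutFloor — §1–§2 of the decomp-res node «FloorCut» (lens-3 g14 rev 1, HOME decomp-res-lens-3/g14/FloorCut.lean
sha256 a6cd0c219cc20b64; critic row 94 / LEDGER line 115 CLEARED)

Tree file 1/3, route-independent and OUTSIDE the Theses cone: §1 walk arithmetic (tree facts assembled; the lens's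
`walk_ord_lt` / `degree_eq_sum3` / `fin3_eq_of_ne` are the
tree's `NoJump.order_lt_two_mul`  / `Literature.Combinatorics.Extremal.finsuppDegree_fin_three` (its closure is not
imported here: `Finsupp.degree_eq_sum` +
`Fin.sum_univ_three` are rewritten inline) / `ExitLaw.fin3_eq_of_ne_of_ne` and are
NOT restated — gate dedup of p777604; the two cone-module ones are inlined where file 2 needs them) and §2 FLOOR
ABSORPTION — at order `q` on a plateau the boundary freezes — VERBATIM from the
lens file.  The node
record (lens header) is in `FloorCutClasses` (file 2/3); the exact cut of the parent residual, the wiring to 31770 /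
31870 and the
NoJump / ProximityCut discharges BY NAME are in `MaxContactCutFloorCut` (file 3/3).
[WRITER NOTE (decomp-res writer g5): the lens file imports `MaxContactCutItineraryCut` /
`MaxContactCutExponentLadder` / `NoJump`
(all inside the Theses cone); files 1–2 are re-based on the cone-free `ItineraryCutClasses` / `BoundaryLedgerClasses` /
`JumpCutModel` so that the route file can import `FloorCutClasses` for the asides without an import cycle.]
(Sources: Hauser2010 §§D,F,G; HauserPerlega2019; CossartJannsenSaito2020 Def. 5.34; CossartPiltant2019; Moh1987.)
-/

open MvPolynomial Finset
open Literature.AlgebraicGeometry.Resolution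
open Literature.AlgebraicGeometry.Resolution.Hauser2010
open Literature.AlgebraicGeometry.Resolution.PointBlowup
open Summit.ResolutionOfSingularities.ResolutionOfSingularities.Theorems.TightDefectClasses
open Summit.ResolutionOfSingularities.ResolutionOfSingularities.Theorems.TightDefectStrongWalks
open Summit.ResolutionOfSingularities.ResolutionOfSingularities.Theorems.ItineraryCutClasses
open Summit.ResolutionOfSingularities.ResolutionOfSingularities.Theorems.BoundaryLedger

namespace Summit.ResolutionOfSingularities.ResolutionOfSingularities.Theorems.FloorCut

/-! ## §1 Walk arithmetic (tree facts assembled; lens-3 g13's light landing `walk_ord_lt` =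
`NoJump.order_lt_two_mul`, re-proved from the tree) -/

section WalkArith

variable {K : Type} [Field K] [DecidableEq K] {q : ℕ} {s₀ : State (Fin 3) K}

/-- An index of `Fin 3` other than a given one. [folklore] -/
theorem exists_ne (j : Fin 3) : ∃ k : Fin 3, k ≠ j :=
  ⟨j + 1, fun h => absurd (congrArg Fin.val h) (by fin_omega)⟩

/-- The kept part is pointwise below the boundary. [folklore] -/
theorem kept_le (W : ForcedWalk q s₀) (t : ℕ) (i : Fin 3) : kept W t i ≤ (W.st t).r i := by
  rw [kept_apply]
  split_ifs
  · exact le_rfl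
  · exact Nat.zero_le _

/-- The kept mass is below the boundary mass. [folklore] -/
theorem kept_degree_le (W : ForcedWalk q s₀) (t : ℕ) : (kept W t).degree ≤ (W.st t).r.degree := by
  rw [Finsupp.degree_eq_sum, Fin.sum_univ_three, Finsupp.degree_eq_sum, Fin.sum_univ_three]
  have h0 := kept_le W t 0
  have h1 := kept_le W t 1
  have h2 := kept_le W t 2
  omega

/-- A kept part of full mass IS the boundary. [folklore] -/
theorem kept_eq_of_degree_eq (W : ForcedWalk q s₀) (t : ℕ) (h : (kept W t).degree = (W.st t).r.degree) :
    kept W t = (W.st t).r := by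
  rw [Finsupp.degree_eq_sum, Fin.sum_univ_three, Finsupp.degree_eq_sum, Fin.sum_univ_three] at h
  have h0 := kept_le W t 0
  have h1 := kept_le W t 1
  have h2 := kept_le W t 2
  ext i
  fin_cases i
  · show kept W t 0 = (W.st t).r 0
    omega
  · show kept W t 1 = (W.st t).r 1
    omega
  · show kept W t 2 = (W.st t).r 2
    omega

/-- On a plateau of height `s` the order is `s` plus the boundary mass (ℕ-bookkeeping). [folklore] -/
theorem order_eq_of_plateau (hroot : IsRoot q s₀) (W : ForcedWalk q s₀) {t o s : ℕ}
    (ho : ordZero (W.st t).F = o) (hs : (W.st t).shade = (s : ℕ∞)) : o = s + (W.st t).r.degree := by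
  obtain ⟨s', hs', hos⟩ := order_eq_shade_add_degree hroot W t ho
  rw [hs] at hs'
  have : s = s' := by exact_mod_cast hs'
  omega

end WalkArith

/-! ## §2 FLOOR ABSORPTION: at order `q` on a plateau the boundary freezes -/

section Floor

variable {K : Type} [Field K] [DecidableEq K] {q : ℕ} {s₀ : State (Fin 3) K}

/-- **One floor step (PROVED).**  On a plateau (`shade_t = shade_{t+1} = s`), if `o_t = q` then `o_{t+1} = q`, every old
component is kept (`kept_t = r_t`) and the boundary does not move (`r_{t+1} = r_t`):
`m_{t+1} = |kept_t| ≤ m_t = q − s` against `o_{t+1} = s + m_{t+1} ≥ q`. [folklore] -/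
theorem floor_step (hroot : IsRoot q s₀) (W : ForcedWalk q s₀) {t s : ℕ}
    (hs0 : (W.st t).shade = (s : ℕ∞)) (hs1 : (W.st (t + 1)).shade = (s : ℕ∞))
    (ho : ordZero (W.st t).F = ((q : ℕ) : ℕ∞)) :
    ordZero (W.st (t + 1)).F = ((q : ℕ) : ℕ∞) ∧ kept W t = (W.st t).r ∧ (W.st (t + 1)).r = (W.st t).r := by
  classical
  have hm : q = s + (W.st t).r.degree := order_eq_of_plateau hroot W ho hs0
  obtain ⟨o', ho', hqo'⟩ := walk_nat hroot W (t + 1)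
  have hm' : o' = s + (W.st (t + 1)).r.degree := order_eq_of_plateau hroot W ho' hs1
  have hdeg : (W.st (t + 1)).r.degree = (kept W t).degree + (q - q) := degree_r_succ W t ho
  have hkle := kept_degree_le W t
  have hkeq : (kept W t).degree = (W.st t).r.degree := by omega
  have hk : kept W t = (W.st t).r := kept_eq_of_degree_eq W t hkeq
  refine ⟨?_, hk, ?_⟩
  · rw [ho']
    have : o' = q := by omega
    exact_mod_cast this
  · rw [r_succ_eq W t ho, hk, Nat.sub_self, Finsupp.single_zero, add_zero]

/-- **FLOOR ABSORPTION (PROVED).**  On a plateau from time `N`, if `o_{t₀} = q` at some `t₀ ≥ N` then for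
every `t ≥ t₀`:
`o_t = q`, `kept_t = r_t` and `r_t = r_{t₀}` — the order floor is absorbing and the boundary is frozen. [folklore] -/
theorem floor_absorbing (hroot : IsRoot q s₀) (W : ForcedWalk q s₀) {N s t₀ : ℕ}
    (hplat : ∀ t, N ≤ t → (W.st t).shade = (s : ℕ∞)) (ht₀ : N ≤ t₀)
    (ho : ordZero (W.st t₀).F = ((q : ℕ) : ℕ∞)) :
    ∀ t, t₀ ≤ t → ordZero (W.st t).F = ((q : ℕ) : ℕ∞) ∧ kept W t = (W.st t).r ∧ (W.st t).r = (W.st t₀).r := by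
  intro t ht
  induction t, ht using Nat.le_induction with
  | base =>
    exact ⟨ho, (floor_step hroot W (hplat t₀ ht₀) (hplat (t₀ + 1) (by omega)) ho).2.1, rfl⟩
  | succ t ht ih =>
    obtain ⟨hot, -, hrt⟩ := ih
    obtain ⟨ho1, -, hr1⟩ := floor_step hroot W (hplat t (by omega)) (hplat (t + 1) (by omega)) hot
    obtain ⟨-, hk2, -⟩ := floor_step hroot W (hplat (t + 1) (by omega)) (hplat (t + 2) (by omega)) ho1
    exact ⟨ho1, hk2, hr1.trans hrt⟩

/-- **Frozen components are hugged (PROVED).**  Past a floor time, a positive component `i` of the frozen boundary is never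
the chart and always contains the next point: `j_t ≠ i` and `b_t i = 0`. [folklore] -/
theorem floor_hugs (hroot : IsRoot q s₀) (W : ForcedWalk q s₀) {N s t₀ : ℕ}
    (hplat : ∀ t, N ≤ t → (W.st t).shade = (s : ℕ∞)) (ht₀ : N ≤ t₀)
    (ho : ordZero (W.st t₀).F = ((q : ℕ) : ℕ∞)) {i : Fin 3} (hi : 0 < (W.st t₀).r i) :
    ∀ t, t₀ ≤ t → W.j t ≠ i ∧ W.b t i = 0 := by
  intro t ht
  obtain ⟨-, hk, hr⟩ := floor_absorbing hroot W hplat ht₀ ho t ht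
  have h : kept W t i = (W.st t₀).r i := by rw [hk, hr]
  rw [kept_apply, hr] at h
  by_cases hc : i ≠ W.j t ∧ W.b t i = 0
  · exact ⟨fun h' => hc.1 h'.symm, hc.2⟩
  · rw [if_neg hc] at h
    omega

/-- **Two frozen components pin the walk to the origin (PROVED).**  If two distinct components are positive at a floor time,
every later move is untranslated (`b_t = 0`): the point lies on both components and on the new one. [folklore] -/
theorem floor_origin_of_two (hroot : IsRoot q s₀) (W : ForcedWalk q s₀) {N s t₀ : ℕ}
    (hplat : ∀ t, N ≤ t → (W.st t).shade = (s : ℕ∞)) (ht₀ : N ≤ t₀)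
    (ho : ordZero (W.st t₀).F = ((q : ℕ) : ℕ∞)) {i₁ i₂ : Fin 3} (h12 : i₁ ≠ i₂)
    (h1 : 0 < (W.st t₀).r i₁) (h2 : 0 < (W.st t₀).r i₂) : ∀ t, t₀ ≤ t → W.b t = 0 := by
  intro t ht
  obtain ⟨hj1, hb1⟩ := floor_hugs hroot W hplat ht₀ ho h1 t ht
  obtain ⟨hj2, hb2⟩ := floor_hugs hroot W hplat ht₀ ho h2 t ht
  funext l
  by_cases hl1 : l = i₁
  · rw [hl1, hb1]; rfl
  by_cases hl2 : l = i₂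
  · rw [hl2, hb2]; rfl
  have key : ∀ i₁ i₂ j l : Fin 3, i₁ ≠ i₂ → j ≠ i₁ → j ≠ i₂ → l ≠ i₁ → l ≠ i₂ → l = j := by decide
  rw [key _ _ _ _ h12 hj1 hj2 hl1 hl2, W.onExc t]
  rfl

/-- **FLOOR ⇒ ONE FROZEN EDGE (PROVED).**  On a plateau of height `s < q` with translated moves at infinitely many times, a
floor time `t₀` (`o_{t₀} = q`) freezes the boundary to a SINGLE component of multiplicity `q − s`:
`r_t = (q − s)·e_i` for all `t ≥ t₀`. [folklore] -/
theorem floor_single (hroot : IsRoot q s₀) (W : ForcedWalk q s₀) {N s t₀ : ℕ} (hsq : s < q)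
    (hplat : ∀ t, N ≤ t → (W.st t).shade = (s : ℕ∞)) (ht₀ : N ≤ t₀)
    (ho : ordZero (W.st t₀).F = ((q : ℕ) : ℕ∞)) (htr : ∀ M : ℕ, ∃ t, M ≤ t ∧ W.b t ≠ 0) :
    ∃ i : Fin 3, ∀ t, t₀ ≤ t → (W.st t).r = Finsupp.single i (q - s) := by
  classical
  have hm : q = s + (W.st t₀).r.degree := order_eq_of_plateau hroot W ho (hplat t₀ ht₀)
  have hsum : (W.st t₀).r.degree = (W.st t₀).r 0 + (W.st t₀).r 1 + (W.st t₀).r 2 := by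
    rw [Finsupp.degree_eq_sum, Fin.sum_univ_three]
  -- some component is positive (`m_{t₀} = q − s ≥ 1`)
  obtain ⟨i, hi⟩ : ∃ i, 0 < (W.st t₀).r i := by
    by_contra h
    push Not at h
    have h0 := h 0; have h1 := h 1; have h2 := h 2
    omega
  -- no other component is positive (else the walk is pinned to the origin, against the translations)
  have hzero : ∀ i', i' ≠ i → (W.st t₀).r i' = 0 := by
    intro i' hi'
    by_contra hne
    obtain ⟨t, ht, hbt⟩ := htr t₀
    exact hbt (floor_origin_of_two hroot W hplat ht₀ ho (Ne.symm hi') hi (Nat.pos_of_ne_zero hne) t ht)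
  -- hence the boundary is the single component `i`, of full mass `q − s`
  have hr : (W.st t₀).r = Finsupp.single i ((W.st t₀).r i) := by
    ext l
    by_cases hl : l = i
    · rw [hl, Finsupp.single_eq_same]
    · rw [Finsupp.single_eq_of_ne hl, hzero l hl]
  have hval : (W.st t₀).r i = q - s := by
    have hd := congrArg Finsupp.degree hr
    rw [Finsupp.degree_single] at hd
    omega
  refine ⟨i, fun t ht => ?_⟩
  rw [(floor_absorbing hroot W hplat ht₀ ho t ht).2.2, hr, hval]

end Floor

end Summit.ResolutionOfSingularities.ResolutionOfSingularities.Theorems.FloorCut
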